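import Summits.CriticalPhenomena.CardyFormulaZ2.Theses.CardyQContinuation
import Literature.Barriers.CriticalPhenomena.EmbeddingModulusUniquenessProofs
import Summits.CriticalPhenomena.CardyFormulaZ2.Theorems.CardyQContinuationIsingJetsConformalStubHigherJetLimitsConformal
import Summits.CriticalPhenomena.CardyFormulaZ2.Theorems.CardyQContinuationIsingJetsConformalStubMirrorCrossingRatio
import Summits.CriticalPhenomena.CardyFormulaZ2.Theorems.CardyQContinuationIsingJetsConformalStubIsingCrossingConformalOfLoopSymmetric
import Literature.Probability.LatticeModels.FKIsingQuadrilateralCrossing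
import Summits.CriticalPhenomena.CardyFormulaZ2.Theorems.CardyQContinuationIsingJetsConformalStubAssemblyUpper
import Summits.CriticalPhenomena.CardyFormulaZ2.Theorems.CardyQContinuationIsingJetsConformalStubAssemblyLower
import Summits.CriticalPhenomena.CardyFormulaZ2.Theorems.CardyQContinuationIsingJetsConformalStubDesignLowerContinuum
import Summits.CriticalPhenomena.CardyFormulaZ2.Theorems.CardyQContinuationIsingJetsConformalStubDesignLeftInterior
import Summits.CriticalPhenomena.CardyFormulaZ2.Theorems.CardyQContinuationIsingJetsConformalStubDesignUpperGluing
import Summits.CriticalPhenomena.CardyFormulaZ2.Theorems.CardyQContinuationIsingJetsConformalStubDesignLowerGluing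
import Summits.CriticalPhenomena.CardyFormulaZ2.Theorems.CardyQContinuationIsingJetsConformalStubDesignSquareModel
import Summits.CriticalPhenomena.CardyFormulaZ2.Theorems.CardyQContinuationIsingJetsConformalStubDesignUpperContinuum

/-!
# Skeleton of line `registered` (reshape 4, lead c3) — crux `CardyQContinuation.IsingJetsConformal`
# (item stmt-CriticalPhenomena-5560, route `route-CriticalPhenomena-CardyQContinuation`)

Lead prover `prover-line-stmt-CriticalPhenomena-5560-c1-0`, 2026-08-17. This is the planner's birth
skeleton `Cruxes/IsingJetsConformal/Lines/birth.lean` with its third stub (conformal covariance of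
the higher jets, stated through EQUAL CROSS-RATIOS of uniformizing data) cut along the seam that the
first wave exposed: "equal cross-ratio" is pure Möbius/Carathéodory geometry and is PROVED
(`stub_higherJetLimitsConformal_markedEquivalence`, worker B: equal orientation + equal cross-ratio ⇒
the two marked rectangles are conformally equivalent with boundary values at the marked points; the
opposite orientation is the chirality of the mirror image, `isUniformizing_strictMono_iff`), so what is
genuinely new is only COVARIANCE of the jet limits under conformal equivalences of marked rectangles
(`stub_higherJetCovariance`) plus the EXACT lattice mirror symmetry of the crossing ratio
(`stub_mirrorCrossingRatio`: `P_δ` of the complex-conjugate rectangle equals `P_δ`, an equivariance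
of Smirnov's discretisation under `(x, y) ↦ (x, -y)`, provable now). Stubs (5 ≤ stubs_max = 7):

* `stub_isingCrossingConformal` (n = 0; Chelkak–Smirnov 2012 Thm 6.1 transplanted; unchanged) — by
  worker A's bridge (`Theorems/CardyQContinuationIsingJetsConformalStubIsingCrossingConformal*.lean`,
  p144240/p144247) it is now literally "CS Thm 6.1 in the loop-symmetric normalisation on the
  `meshDomain`/`discreteArc` discretisation" + 5 lines;
* `stub_higherJetLimitsExist` (n ≥ 1 existence per rectangle; unchanged; n = 1 is the route's crux
  `FirstJetConverges` = stmt-CriticalPhenomena-5561 up to `iteratedDeriv_one`);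
* `stub_higherJetLimitsConformal_markedEquivalence` (CLOSED: proved by worker B, landed p144394 =
  `Theorems/CardyQContinuationIsingJetsConformalStubHigherJetLimitsConformal.lean`, imported; no sorry);
* `stub_higherJetCovariance` (n ≥ 1, NEW mathematics: jet limits are invariant under conformal
  equivalences of marked rectangles — the form in which any Chelkak–Smirnov-type covariance theorem
  is stated and proved; worker D landed its bookkeeping p145460: `isUniformizing_trans`, arc transport
  `exists_extension_arc_eq`, and `higherJetCovariance_of_crossRatioForm` = planner's stub 3 ⇒ 3b, so the
  reshaped cut is an equivalence);
* `stub_mirrorCrossingRatio` (exact reflection symmetry, all `δ > 0`, all complex `s`; CLOSED: proved by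
  worker C via the tree's `CellSymmetry` transport, landed p145626 =
  `Theorems/CardyQContinuationIsingJetsConformalStubMirrorCrossingRatio.lean`, imported; no sorry).

RESHAPE 2 (lead `prover-line-stmt-CriticalPhenomena-5560-c2-0`, 2026-08-17, cycle 2). Stub 1 is
cut along the seam "published scaling-limit theorem / lattice bridge": Chelkak–Smirnov 2012 Thm 6.1
(square lattice, UNIFORM form over CS discrete quadrilaterals) is now a Literature named fact
`Literature.Probability.LatticeModels.ChelkakSmirnov2012_fkIsingQuadrilateralCrossing` (p158372,
unproved `def … : Prop`, carried as the registered stub `stub_chelkakSmirnovQuadrilateralCrossing` — the crux is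
unconditional and its n = 0 case IS that theorem, so the line owns it as an obligation), and the registered stub is the
BRIDGE `stub_loopSymmetricLimit_of_chelkakSmirnov : CS-fact → H_LS` (deterministic lattice
geometry + FK monotonicity/planar duality + Carathéodory-kernel convergence of the lattice polygons;
anatomy in `Lines/birth-n0-bridge.md`: outer CS hull of `meshDomain` (D), planar self-duality of the
loop-symmetric ratio (E), kernel + ULC convergence ⇒ cross-ratio convergence (F), harmonic measure of
polygon arcs (G)); `H_LS → stub 1` is the landed `stub_isingCrossingConformal_of_loopSymmetricLimit`
(p148640). Landed n = 0 geometry sub-goals (c2): `…_frontier_near_meshBoundary` (p156860),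
`…_meshBoundary_eq_iUnion_discreteArc` (p158964), `…_discreteArc_near_pt_of_close` (p158999),
`…_arc_near_discreteArc` (p159031); landed 3b sub-goal `stub_higherJetCovariance_scaling` (p156912,
exact homothety covariance). Open registered stubs after reshape 2: `stub_chelkakSmirnovQuadrilateralCrossing` (the named fact
itself, XL, in print), `stub_loopSymmetricLimit_of_chelkakSmirnov` (n = 0 bridge, L–XL, provable in principle), `stub_higherJetLimitsExist` (2), `stub_higherJetCovariance` (3b).

RESHAPE 3 (lead `prover-line-stmt-CriticalPhenomena-5560-c3-0`, 2026-08-17, cycle 3). Lead c2's plan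
for stub 1′ (exact planar duality on `Ω_δ` + outer CS hulls) fails at "pockets": the wired discrete arcs
`discreteArc ⊆ meshBoundary` miss every reflex corner of the boundary polyline, whereas Chelkak–Smirnov wire
the whole polyline, and no monotone/dual embedding repairs it (`Lines/birth-n0-bridge-c3.md` §1). The
replacement is a surgery-free SANDWICH (ibid. §§2–3, 8–10): glue DESIGNED nice quadrilaterals to `Ω_δ` in the
zones where `meshBoundary` is wired (any glued edge touches `Ω_δ` only at `meshBoundary` vertices — by
definition), compare by FK monotonicity + conditional domination, remove wired–wired decorations exactly, apply
the named fact to the designed quads, and pass to the limit by Radó. Stub 1′ is now DERIVED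
(`loopSymmetricLimit_of_chelkakSmirnov_of`) from two registered DESIGN stubs (`stub_design_upper`,
`stub_design_lower`: existence, for every `τ > 0` and all small `δ`, of the glued quadrilaterals with
`C·δ`-close polygonal boundaries and `τ`-close cross-ratios) and two ASSEMBLY theorems
(`stub_loopSymmetricLimit_assemblyUpper/Lower`, LANDED and imported), which rest on the sub-goals landed in cycle 3:
normalForms p165863, arcLocalisation p165842, sandwichUpper p165810, sandwichLower p165869, pathUpper p165870,
pathLower p165973, harmonicMeasureTransport p166094, discArcHarmonic p166493, succPeriodic p166689,
csLimitAlongSequence p166780, rcMeasure_wired_isolated p166963, polygonLoop_dist_le p167042, upperComparison p167724,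
isRect_of_faces p167935, exteriorInversion p167937, lowerComparison p168323, harmonicMeasureArcLowerBound p168332,
harmonicMeasureAlongSequence p168333, assemblyUpper p168525, assemblyLower p168675, rectilinearPolyomino p169579
(+ Literature `RectilinearPolygonGrid` p169203, `RectilinearPolyomino` p169326).

RESHAPE 4 (lead c3, cycle 3, wave 5). ORIENTATION: `ConformalRectangle`s carry no orientation while the CS boundary
cycle `DiscreteRect.succ` is ccw, so the designed rectangle must be ccw (index 1) even for a cw `R` (relabelling
(0 1)(2 3), Klein-invariance of the cross-ratio) — packaged in the landed ORIENTED SQUARE MODEL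
`stub_design_squareModel` p171364 (+ Literature `QuadPresentations` p170600). DESIGN± are now DERIVED
(`design_upper_of`, `design_lower_of`) from ONE open registered sub-goal G1 `stub_design_meshQuad` (the CS
presentation of the polyomino of a ccw rectilinear polygon: `csDomain` as a Jordan domain `O(δ)`-close to the
polygon, black/white vertex localisation) and the landed wave-5 pieces: E⁺ `stub_design_upper_continuum` p171507,
E⁻ `stub_design_lower_continuum` p170882 (rectilinear shadows of `perturbQuad` images of the wider-shorter /
narrower-taller model rectangles — the sibling RectilinearSuffices toolkit), G0 `stub_design_leftInterior` p170944
(+ Literature `PolygonLeftInterior` p170645: index 1 ⇒ interior on the left of every edge), D1e⁺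
`stub_design_upper_gluing` p170821, D1e⁻ `stub_design_lower_gluing` p170616 (the FK gluing / collar hypotheses).
Open registered stubs after reshape 4 (4): `stub_chelkakSmirnovQuadrilateralCrossing` (named fact), `stub_design_meshQuad`
(G1, XL, worker landing tetrakis-triangulation parts), `stub_higherJetLimitsExist` (2), `stub_higherJetCovariance` (3b).

`higherJetLimitsConformal_of` DERIVES the planner's third stub from the last three (same orientation:
marked equivalence + covariance; opposite orientation: pass to the conjugate rectangle `R*`, which
carries the datum `(z ↦ conj (φ (-z̄)), -x)` of opposite chirality and the same cross-ratio —
`MarkedDomain.IsUniformizing.exists_conjugate`, `crossRatio_neg` — and has the same `P_δ` by the mirror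
stub), and `IsingJetsConformal_of` is the birth composition run on it. Sorries: exactly the `stub_*`.
Disproof used: none exists for this crux (no `Disproof.lean`, no `Negative/*`, 2026-08-17).
-/

namespace Summit.CriticalPhenomena.CardyFormulaZ2.Cruxes.IsingJetsConformal.Birth

open scoped BigOperators Topology Classical
open Filter Set
open Summit.CriticalPhenomena.CardyFormulaZ2.Theses.CardyQContinuation (IsingJetsConformal)

/-! ### The stub statements as named `Prop`s (D-0027 §3.3 shape) -/

namespace Stubs

/-- Stub `Prop` 1 — JetsZero (registered stub `stub_isingCrossingConformal`). -/
def stub_isingCrossingConformal : Prop :=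
  let w : Literature.Probability.RandomPlanarGeometry.ConformalRectangle → ℝ → ℂ → Set (Sym2 (Literature.Probability.LatticeModels.Site 2)) → ℂ := fun R δ s ω ↦ s ^ (ω.ncard + 2 * Nat.card ((Literature.Probability.Percolation.openGraph ω ⊔ Literature.Probability.LatticeModels.wired (Literature.Probability.LatticeModels.discreteArc R.carrier δ (R.arc 0) ∪ Literature.Probability.LatticeModels.discreteArc R.carrier δ (R.arc 2))).induce (Literature.Probability.LatticeModels.meshDomain R.carrier δ)).ConnectedComponent); let P : Literature.Probability.RandomPlanarGeometry.ConformalRectangle → ℝ → ℂ → ℂ := fun R δ s ↦ (∑ᶠ ω ∈ 𝒫 (Literature.Probability.LatticeModels.discreteDomainGraph R.carrier δ).edgeSet, (Literature.Probability.Percolation.discreteCrossing R.carrier δ (R.arc 0) (R.arc 2)).indicator (w R δ s) ω) / (∑ᶠ ω ∈ 𝒫 (Literature.Probability.LatticeModels.discreteDomainGraph R.carrier δ).edgeSet, w R δ s ω); ∃ c : ℝ → ℂ, ∀ (R : Literature.Probability.RandomPlanarGeometry.ConformalRectangle) (φ : Literature.Probability.RandomPlanarGeometry.ConformalEquiv UpperHalfPlane.upperHalfPlaneSet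 R.carrier) (x : Fin 4 → ℝ), R.IsUniformizing φ x → Filter.Tendsto (fun δ ↦ P R δ (Real.sqrt 2 : ℂ)) (nhdsWithin 0 (Set.Ioi 0)) (nhds (c (Literature.Probability.RandomPlanarGeometry.crossRatio x)))

/-- Stub `Prop` 0 — the published n = 0 INPUT (registered stub `stub_chelkakSmirnovQuadrilateralCrossing`,
reshape 2): Chelkak–Smirnov 2012 Thm 6.1 itself, i.e. the tree's named fact
`Literature.Probability.LatticeModels.ChelkakSmirnov2012_fkIsingQuadrilateralCrossing` (unproved
`def … : Prop`, p158372). The crux is unconditional, so the line carries the fact as an obligation: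
discharging it = formalising CS2012 §3–§6 (XL, in print). -/
def stub_chelkakSmirnovQuadrilateralCrossing : Prop :=
  Literature.Probability.LatticeModels.ChelkakSmirnov2012_fkIsingQuadrilateralCrossing

/-- Stub `Prop` 1′ — the n = 0 BRIDGE (registered stub `stub_loopSymmetricLimit_of_chelkakSmirnov`,
reshape 2): Chelkak–Smirnov 2012 Thm 6.1 (the tree's named fact, uniform over CS discrete
quadrilaterals of `δℤ²`) implies the loop-symmetric crossing limit `H_LS` on the
`meshDomain`/`discreteArc` discretisation of every conformal rectangle. -/
def stub_loopSymmetricLimit_of_chelkakSmirnov : Prop :=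
  (Literature.Probability.LatticeModels.ChelkakSmirnov2012_fkIsingQuadrilateralCrossing → (∃ c : ℝ → ℝ, ∀ (R : Literature.Probability.RandomPlanarGeometry.ConformalRectangle) (φ : Literature.Probability.RandomPlanarGeometry.ConformalEquiv UpperHalfPlane.upperHalfPlaneSet R.carrier) (x : Fin 4 → ℝ), R.IsUniformizing φ x → Filter.Tendsto (fun δ : ℝ ↦ Polynomial.aeval (Real.sqrt 2) (Literature.Probability.LatticeModels.fkTwoArcCrossingPolynomial R δ Literature.Probability.LatticeModels.ArcWiring.joint) / (Polynomial.aeval (Real.sqrt 2) (Literature.Probability.LatticeModels.fkTwoArcCrossingPolynomial R δ Literature.Probability.LatticeModels.ArcWiring.joint) + Real.sqrt 2 * (Polynomial.aeval (Real.sqrt 2) (Literature.Probability.LatticeModels.fkTwoArcPartitionPolynomials R δ Literature.Probability.LatticeModels.ArcWiring.joint) - Polynomial.aeval (Real.sqrt 2) (Literature.Probability.LatticeModels.fkTwoArcCrossingPolynomial R δ Literature.Probability.LatticeModels.ArcWiring.joint)))) (nhdsWithin 0 (Set.Ioi 0)) (nhds (c (Literature.Probability.RandomPlanarGeometry.crossRatio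 x)))))

/-- Stub `Prop` DESIGN⁺ (reshape 3, lead c3): for every conformal rectangle `R` and `τ > 0` there is an
outer-type approximant `Rp` (wired arcs pushed into `Ω` through a thick wired collar, free arcs pushed out)
with `τ`-close cross-ratios and, for all small `δ`, a Chelkak–Smirnov quadrilateral glued to `Ω_δ` with
`C·δ`-close polygonal boundary/corners and the gluing hypotheses of `stub_loopSymmetricLimit_upperComparison`
(pieces E, D1a–e of `Lines/birth-n0-bridge-c3.md`). Registered stub `stub_design_upper`. -/
def stub_design_upper : Prop :=
  (∀ (R : Literature.Probability.RandomPlanarGeometry.ConformalRectangle) (τ : ℝ), 0 < τ → ∃ (Rp : Literature.Probability.RandomPlanarGeometry.ConformalRectangle) (C : ℝ), (∀ (φ : Literature.Probability.RandomPlanarGeometry.ConformalEquiv UpperHalfPlane.upperHalfPlaneSet R.carrier) (x : Fin 4 → ℝ), R.IsUniformizing φ x → ∀ (φ' : Literature.Probability.RandomPlanarGeometry.ConformalEquiv UpperHalfPlane.upperHalfPlaneSet Rp.carrier) (x' : Fin 4 → ℝ), Rp.IsUniformizing φ' x' → |Literature.Probability.RandomPlanarGeometry.crossRatio x' - Literature.Probability.RandomPlanarGeometry.crossRatio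 x| < τ) ∧ ∀ᶠ δ in nhdsWithin (0 : ℝ) (Set.Ioi 0), ∃ (E : Finset (Sym2 (Literature.Probability.LatticeModels.Site 2))) (d₀ : Literature.Probability.LatticeModels.Site 2 × Fin 4) (n : Fin 4 → ℕ) (Q : Literature.Probability.RandomPlanarGeometry.ConformalRectangle) (Z₀ Z₂ : Set (Literature.Probability.LatticeModels.Site 2)), Literature.Probability.LatticeModels.DiscreteRect.IsCSQuadrilateral E d₀ n ∧ Literature.Probability.LatticeModels.DiscreteRect.csDomain E d₀ n δ = Q.carrier ∧ (∀ j : Fin 4, Q.pt j = Literature.Probability.LatticeModels.meshPoint δ (Literature.Probability.LatticeModels.DiscreteRect.csCorner E d₀ n j)) ∧ Q.arc 0 ⊆ Literature.Probability.LatticeModels.DiscreteRect.blackArc E d₀ n δ 0 ∧ Q.arc 2 ⊆ Literature.Probability.LatticeModels.DiscreteRect.blackArc E d₀ n δ 2 ∧ (∀ t : ℝ, dist (Q.boundary t) (Rp.boundary t) ≤ C * δ) ∧ (∀ j : Fin 4, dist (Q.pt j) (Rp.pt j) ≤ C * δ) ∧ Disjoint Z₀ Z₂ ∧ Literature.Probability.LatticeModels.discreteArc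 R.carrier δ (R.arc 0) ⊆ Z₀ ∧ Literature.Probability.LatticeModels.discreteArc R.carrier δ (R.arc 2) ⊆ Z₂ ∧ Literature.Probability.LatticeModels.DiscreteRect.blackVerts E d₀ n 0 ⊆ Z₀ ∧ Literature.Probability.LatticeModels.DiscreteRect.blackVerts E d₀ n 2 ⊆ Z₂ ∧ (∀ x ∈ Z₀, ∀ y ∈ Z₂, ¬ (Literature.Probability.LatticeModels.discreteDomainGraph R.carrier δ).Adj x y ∧ s(x, y) ∉ E) ∧ (∀ v ∈ Z₀ ∪ Z₂, v ∈ (Literature.Probability.LatticeModels.DiscreteRect.verts E : Set (Literature.Probability.LatticeModels.Site 2)) → v ∈ Literature.Probability.LatticeModels.DiscreteRect.blackVerts E d₀ n 0 ∪ Literature.Probability.LatticeModels.DiscreteRect.blackVerts E d₀ n 2) ∧ (∀ v, v ∈ Literature.Probability.LatticeModels.meshDomain R.carrier δ ∪ (Literature.Probability.LatticeModels.DiscreteRect.verts E : Set (Literature.Probability.LatticeModels.Site 2)) → v ∉ Z₀ ∪ Z₂ → v ∈ (Literature.Probability.LatticeModels.DiscreteRect.verts E : Set (Literature.Probability.LatticeModels.Site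 2)) ∧ v ∉ Literature.Probability.LatticeModels.DiscreteRect.blackVerts E d₀ n 0 ∪ Literature.Probability.LatticeModels.DiscreteRect.blackVerts E d₀ n 2) ∧ (∀ x y : Literature.Probability.LatticeModels.Site 2, (Literature.Probability.LatticeModels.discreteDomainGraph R.carrier δ).Adj x y → s(x, y) ∉ E → x ∈ Z₀ ∪ Z₂))

/-- Stub `Prop` DESIGN⁻ (reshape 3, lead c3): the inner-type approximant (wired arcs pushed out of `Ω̄`,
glued along two collars attached at the wired discrete arcs; hypotheses of
`stub_loopSymmetricLimit_lowerComparison`). Registered stub `stub_design_lower`. -/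
def stub_design_lower : Prop :=
  (∀ (R : Literature.Probability.RandomPlanarGeometry.ConformalRectangle) (τ : ℝ), 0 < τ → ∃ (Rm : Literature.Probability.RandomPlanarGeometry.ConformalRectangle) (C : ℝ), (∀ (φ : Literature.Probability.RandomPlanarGeometry.ConformalEquiv UpperHalfPlane.upperHalfPlaneSet R.carrier) (x : Fin 4 → ℝ), R.IsUniformizing φ x → ∀ (φ' : Literature.Probability.RandomPlanarGeometry.ConformalEquiv UpperHalfPlane.upperHalfPlaneSet Rm.carrier) (x' : Fin 4 → ℝ), Rm.IsUniformizing φ' x' → |Literature.Probability.RandomPlanarGeometry.crossRatio x' - Literature.Probability.RandomPlanarGeometry.crossRatio x| < τ) ∧ ∀ᶠ δ in nhdsWithin (0 : ℝ) (Set.Ioi 0), ∃ (E : Finset (Sym2 (Literature.Probability.LatticeModels.Site 2))) (d₀ : Literature.Probability.LatticeModels.Site 2 × Fin 4) (n : Fin 4 → ℕ) (Q : Literature.Probability.RandomPlanarGeometry.ConformalRectangle) (C₀ C₂ : Set (Sym2 (Literature.Probability.LatticeModels.Site 2))), Literature.Probability.LatticeModels.DiscreteRect.IsCSQuadrilateral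 E d₀ n ∧ Literature.Probability.LatticeModels.DiscreteRect.csDomain E d₀ n δ = Q.carrier ∧ (∀ j : Fin 4, Q.pt j = Literature.Probability.LatticeModels.meshPoint δ (Literature.Probability.LatticeModels.DiscreteRect.csCorner E d₀ n j)) ∧ Q.arc 0 ⊆ Literature.Probability.LatticeModels.DiscreteRect.blackArc E d₀ n δ 0 ∧ Q.arc 2 ⊆ Literature.Probability.LatticeModels.DiscreteRect.blackArc E d₀ n δ 2 ∧ (∀ t : ℝ, dist (Q.boundary t) (Rm.boundary t) ≤ C * δ) ∧ (∀ j : Fin 4, dist (Q.pt j) (Rm.pt j) ≤ C * δ) ∧ Disjoint (Literature.Probability.LatticeModels.DiscreteRect.blackVerts E d₀ n 0) (Literature.Probability.LatticeModels.DiscreteRect.blackVerts E d₀ n 2) ∧ (∀ v ∈ Literature.Probability.LatticeModels.DiscreteRect.blackVerts E d₀ n 0 ∪ Literature.Probability.LatticeModels.DiscreteRect.blackVerts E d₀ n 2, v ∉ Literature.Probability.LatticeModels.meshDomain R.carrier δ) ∧ (∀ e ∈ E, e ∉ (Literature.Probability.LatticeModels.discreteDomainGraph R.carrier δ).edgeSet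 → e ∈ C₀ ∪ C₂) ∧ (∀ x : Literature.Probability.LatticeModels.Site 2, (∃ e ∈ C₀, x ∈ e) → (∃ y, (Literature.Probability.LatticeModels.discreteDomainGraph R.carrier δ).Adj x y) → x ∈ Literature.Probability.LatticeModels.discreteArc R.carrier δ (R.arc 0)) ∧ (∀ x : Literature.Probability.LatticeModels.Site 2, (∃ e ∈ C₂, x ∈ e) → (∃ y, (Literature.Probability.LatticeModels.discreteDomainGraph R.carrier δ).Adj x y) → x ∈ Literature.Probability.LatticeModels.discreteArc R.carrier δ (R.arc 2)) ∧ (∀ x : Literature.Probability.LatticeModels.Site 2, (∃ e ∈ C₀, x ∈ e) → ¬ ∃ e ∈ C₂, x ∈ e) ∧ (∀ x ∈ Literature.Probability.LatticeModels.DiscreteRect.blackVerts E d₀ n 0, ∀ e ∈ E, x ∈ e → e ∈ C₀) ∧ (∀ y ∈ Literature.Probability.LatticeModels.DiscreteRect.blackVerts E d₀ n 2, ∀ e ∈ E, y ∈ e → e ∈ C₂))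

/-- Sub-goal `Prop` G1 (wave 5; registered stub `stub_design_meshQuad`): the Chelkak–Smirnov presentation of the
polyomino of a ccw rectilinear polygon at small mesh (the last open piece of DESIGN±). -/
def stub_design_meshQuad : Prop :=
  (∀ (Rp : Literature.Probability.RandomPlanarGeometry.ConformalRectangle) (l : List ℂ) (h : Literature.Probability.RandomPlanarGeometry.IsSimpleClosedPolygon l) (ρ : ℝ → ℝ), (∀ (k : ℕ) (hk : k < l.length), (l[k]).re = (l[(k + 1) % l.length]'(Nat.mod_lt _ h.pos)).re ∨ (l[k]).im = (l[(k + 1) % l.length]'(Nat.mod_lt _ h.pos)).im) → Continuous ρ → StrictMono ρ → Function.Surjective ρ → (∀ s : ℝ, ρ (s + 1) = ρ s + 1) → Rp.boundary = Literature.Probability.RandomPlanarGeometry.polygonLoop l ∘ ρ → Rp.carrier = (Literature.Probability.RandomPlanarGeometry.polygonDomain l h).carrier → (∀ (k : ℕ) (hk : k < l.length) (θ : ℝ), θ ∈ Set.Ioo (0 : ℝ) 1 → ∀ᶠ s : ℝ in nhdsWithin (0 : ℝ) (Set.Ioi 0), Literature.Probability.RandomPlanarGeometry.polygonLoop l ((k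 + θ) / l.length) + (s : ℂ) * (Complex.I * (l[(k + 1) % l.length]'(Nat.mod_lt _ h.pos) - l[k])) ∈ Rp.carrier) → ∃ C : ℝ, ∀ᶠ δ in nhdsWithin (0 : ℝ) (Set.Ioi 0), ∃ (E : Finset (Sym2 (Literature.Probability.LatticeModels.Site 2))) (d₀ : Literature.Probability.LatticeModels.Site 2 × Fin 4) (n : Fin 4 → ℕ) (Q : Literature.Probability.RandomPlanarGeometry.ConformalRectangle), (Literature.Probability.LatticeModels.DiscreteRect.IsCSQuadrilateral E d₀ n ∧ Literature.Probability.LatticeModels.DiscreteRect.csDomain E d₀ n δ = Q.carrier ∧ (∀ j : Fin 4, Q.pt j = Literature.Probability.LatticeModels.meshPoint δ (Literature.Probability.LatticeModels.DiscreteRect.csCorner E d₀ n j)) ∧ Q.arc 0 ⊆ Literature.Probability.LatticeModels.DiscreteRect.blackArc E d₀ n δ 0 ∧ Q.arc 2 ⊆ Literature.Probability.LatticeModels.DiscreteRect.blackArc E d₀ n δ 2 ∧ (∀ t : ℝ, dist (Q.boundary t) (Rp.boundary t) ≤ C * δ) ∧ (∀ j : Fin 4, dist (Q.pt j) (Rp.pt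 j) ≤ C * δ)) ∧ (∀ e, e ∈ E ↔ ∃ s : Literature.Probability.LatticeModels.Site 2, Literature.Probability.LatticeModels.DiscreteRect.closedSq δ s ⊆ closure Rp.carrier ∧ ∃ j : Fin 4, e = s(Literature.Probability.LatticeModels.DiscreteRect.corner s j, Literature.Probability.LatticeModels.DiscreteRect.corner s j + Literature.Probability.LatticeModels.DiscreteRect.dir j)) ∧ (∀ x ∈ Literature.Probability.LatticeModels.DiscreteRect.blackVerts E d₀ n 0, Metric.infDist (Literature.Probability.LatticeModels.meshPoint δ x) (Rp.arc 0) ≤ C * δ) ∧ (∀ x ∈ Literature.Probability.LatticeModels.DiscreteRect.blackVerts E d₀ n 2, Metric.infDist (Literature.Probability.LatticeModels.meshPoint δ x) (Rp.arc 2) ≤ C * δ) ∧ (∀ x ∈ Literature.Probability.LatticeModels.DiscreteRect.verts E, (∃ k : Fin 4, s(x, x + Literature.Probability.LatticeModels.DiscreteRect.dir k) ∉ E) → x ∈ Literature.Probability.LatticeModels.DiscreteRect.blackVerts E d₀ n 0 ∪ Literature.Probability.LatticeModels.DiscreteRect.blackVerts E d₀ n 2 ∨ Metric.infDist (Literature.Probability.LatticeModels.meshPoint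 δ x) (Rp.arc 1 ∪ Rp.arc 3) ≤ C * δ))

/-- Sub-goal `Prop` H⁺ (registered sub-goal stub `stub_loopSymmetricLimit_assemblyUpper`, lead c3): the
upper assembly — CS fact + DESIGN⁺ ⇒ `limsup LS ≤ p(η)`. -/
def stub_assembly_upper : Prop :=
  (Literature.Probability.LatticeModels.ChelkakSmirnov2012_fkIsingQuadrilateralCrossing → (∀ (R : Literature.Probability.RandomPlanarGeometry.ConformalRectangle) (τ : ℝ), 0 < τ → ∃ (Rp : Literature.Probability.RandomPlanarGeometry.ConformalRectangle) (C : ℝ), (∀ (φ : Literature.Probability.RandomPlanarGeometry.ConformalEquiv UpperHalfPlane.upperHalfPlaneSet R.carrier) (x : Fin 4 → ℝ), R.IsUniformizing φ x → ∀ (φ' : Literature.Probability.RandomPlanarGeometry.ConformalEquiv UpperHalfPlane.upperHalfPlaneSet Rp.carrier) (x' : Fin 4 → ℝ), Rp.IsUniformizing φ' x' → |Literature.Probability.RandomPlanarGeometry.crossRatio x' - Literature.Probability.RandomPlanarGeometry.crossRatio x| < τ) ∧ ∀ᶠ δ in nhdsWithin (0 : ℝ) (Set.Ioi 0), ∃ (E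 : Finset (Sym2 (Literature.Probability.LatticeModels.Site 2))) (d₀ : Literature.Probability.LatticeModels.Site 2 × Fin 4) (n : Fin 4 → ℕ) (Q : Literature.Probability.RandomPlanarGeometry.ConformalRectangle) (Z₀ Z₂ : Set (Literature.Probability.LatticeModels.Site 2)), Literature.Probability.LatticeModels.DiscreteRect.IsCSQuadrilateral E d₀ n ∧ Literature.Probability.LatticeModels.DiscreteRect.csDomain E d₀ n δ = Q.carrier ∧ (∀ j : Fin 4, Q.pt j = Literature.Probability.LatticeModels.meshPoint δ (Literature.Probability.LatticeModels.DiscreteRect.csCorner E d₀ n j)) ∧ Q.arc 0 ⊆ Literature.Probability.LatticeModels.DiscreteRect.blackArc E d₀ n δ 0 ∧ Q.arc 2 ⊆ Literature.Probability.LatticeModels.DiscreteRect.blackArc E d₀ n δ 2 ∧ (∀ t : ℝ, dist (Q.boundary t) (Rp.boundary t) ≤ C * δ) ∧ (∀ j : Fin 4, dist (Q.pt j) (Rp.pt j) ≤ C * δ) ∧ Disjoint Z₀ Z₂ ∧ Literature.Probability.LatticeModels.discreteArc R.carrier δ (R.arc 0) ⊆ Z₀ ∧ Literature.Probability.LatticeModels.discreteArc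 R.carrier δ (R.arc 2) ⊆ Z₂ ∧ Literature.Probability.LatticeModels.DiscreteRect.blackVerts E d₀ n 0 ⊆ Z₀ ∧ Literature.Probability.LatticeModels.DiscreteRect.blackVerts E d₀ n 2 ⊆ Z₂ ∧ (∀ x ∈ Z₀, ∀ y ∈ Z₂, ¬ (Literature.Probability.LatticeModels.discreteDomainGraph R.carrier δ).Adj x y ∧ s(x, y) ∉ E) ∧ (∀ v ∈ Z₀ ∪ Z₂, v ∈ (Literature.Probability.LatticeModels.DiscreteRect.verts E : Set (Literature.Probability.LatticeModels.Site 2)) → v ∈ Literature.Probability.LatticeModels.DiscreteRect.blackVerts E d₀ n 0 ∪ Literature.Probability.LatticeModels.DiscreteRect.blackVerts E d₀ n 2) ∧ (∀ v, v ∈ Literature.Probability.LatticeModels.meshDomain R.carrier δ ∪ (Literature.Probability.LatticeModels.DiscreteRect.verts E : Set (Literature.Probability.LatticeModels.Site 2)) → v ∉ Z₀ ∪ Z₂ → v ∈ (Literature.Probability.LatticeModels.DiscreteRect.verts E : Set (Literature.Probability.LatticeModels.Site 2)) ∧ v ∉ Literature.Probability.LatticeModels.DiscreteRect.blackVerts E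 d₀ n 0 ∪ Literature.Probability.LatticeModels.DiscreteRect.blackVerts E d₀ n 2) ∧ (∀ x y : Literature.Probability.LatticeModels.Site 2, (Literature.Probability.LatticeModels.discreteDomainGraph R.carrier δ).Adj x y → s(x, y) ∉ E → x ∈ Z₀ ∪ Z₂)) → ∀ (R : Literature.Probability.RandomPlanarGeometry.ConformalRectangle) (φ : Literature.Probability.RandomPlanarGeometry.ConformalEquiv UpperHalfPlane.upperHalfPlaneSet R.carrier) (x : Fin 4 → ℝ), R.IsUniformizing φ x → ∀ κ : ℝ, 0 < κ → ∀ᶠ δ in nhdsWithin (0 : ℝ) (Set.Ioi 0), Polynomial.aeval (Real.sqrt 2) (Literature.Probability.LatticeModels.fkTwoArcCrossingPolynomial R δ Literature.Probability.LatticeModels.ArcWiring.joint) / (Polynomial.aeval (Real.sqrt 2) (Literature.Probability.LatticeModels.fkTwoArcCrossingPolynomial R δ Literature.Probability.LatticeModels.ArcWiring.joint) + Real.sqrt 2 * (Polynomial.aeval (Real.sqrt 2) (Literature.Probability.LatticeModels.fkTwoArcPartitionPolynomials R δ Literature.Probability.LatticeModels.ArcWiring.joint) - Polynomial.aeval (Real.sqrt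 2) (Literature.Probability.LatticeModels.fkTwoArcCrossingPolynomial R δ Literature.Probability.LatticeModels.ArcWiring.joint))) < Literature.Probability.LatticeModels.fkIsingCrossingFunction (Literature.Probability.RandomPlanarGeometry.crossRatio x) + κ)

/-- Sub-goal `Prop` H⁻ (registered sub-goal stub `stub_loopSymmetricLimit_assemblyLower`, lead c3): the
lower assembly — CS fact + DESIGN⁻ ⇒ `liminf LS ≥ p(η)`. -/
def stub_assembly_lower : Prop :=
  (Literature.Probability.LatticeModels.ChelkakSmirnov2012_fkIsingQuadrilateralCrossing → (∀ (R : Literature.Probability.RandomPlanarGeometry.ConformalRectangle) (τ : ℝ), 0 < τ → ∃ (Rm : Literature.Probability.RandomPlanarGeometry.ConformalRectangle) (C : ℝ), (∀ (φ : Literature.Probability.RandomPlanarGeometry.ConformalEquiv UpperHalfPlane.upperHalfPlaneSet R.carrier) (x : Fin 4 → ℝ), R.IsUniformizing φ x → ∀ (φ' : Literature.Probability.RandomPlanarGeometry.ConformalEquiv UpperHalfPlane.upperHalfPlaneSet Rm.carrier) (x' : Fin 4 → ℝ), Rm.IsUniformizing φ' x' → |Literature.Probability.RandomPlanarGeometry.crossRatio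 x' - Literature.Probability.RandomPlanarGeometry.crossRatio x| < τ) ∧ ∀ᶠ δ in nhdsWithin (0 : ℝ) (Set.Ioi 0), ∃ (E : Finset (Sym2 (Literature.Probability.LatticeModels.Site 2))) (d₀ : Literature.Probability.LatticeModels.Site 2 × Fin 4) (n : Fin 4 → ℕ) (Q : Literature.Probability.RandomPlanarGeometry.ConformalRectangle) (C₀ C₂ : Set (Sym2 (Literature.Probability.LatticeModels.Site 2))), Literature.Probability.LatticeModels.DiscreteRect.IsCSQuadrilateral E d₀ n ∧ Literature.Probability.LatticeModels.DiscreteRect.csDomain E d₀ n δ = Q.carrier ∧ (∀ j : Fin 4, Q.pt j = Literature.Probability.LatticeModels.meshPoint δ (Literature.Probability.LatticeModels.DiscreteRect.csCorner E d₀ n j)) ∧ Q.arc 0 ⊆ Literature.Probability.LatticeModels.DiscreteRect.blackArc E d₀ n δ 0 ∧ Q.arc 2 ⊆ Literature.Probability.LatticeModels.DiscreteRect.blackArc E d₀ n δ 2 ∧ (∀ t : ℝ, dist (Q.boundary t) (Rm.boundary t) ≤ C * δ) ∧ (∀ j : Fin 4, dist (Q.pt j) (Rm.pt j) ≤ C *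 δ) ∧ Disjoint (Literature.Probability.LatticeModels.DiscreteRect.blackVerts E d₀ n 0) (Literature.Probability.LatticeModels.DiscreteRect.blackVerts E d₀ n 2) ∧ (∀ v ∈ Literature.Probability.LatticeModels.DiscreteRect.blackVerts E d₀ n 0 ∪ Literature.Probability.LatticeModels.DiscreteRect.blackVerts E d₀ n 2, v ∉ Literature.Probability.LatticeModels.meshDomain R.carrier δ) ∧ (∀ e ∈ E, e ∉ (Literature.Probability.LatticeModels.discreteDomainGraph R.carrier δ).edgeSet → e ∈ C₀ ∪ C₂) ∧ (∀ x : Literature.Probability.LatticeModels.Site 2, (∃ e ∈ C₀, x ∈ e) → (∃ y, (Literature.Probability.LatticeModels.discreteDomainGraph R.carrier δ).Adj x y) → x ∈ Literature.Probability.LatticeModels.discreteArc R.carrier δ (R.arc 0)) ∧ (∀ x : Literature.Probability.LatticeModels.Site 2, (∃ e ∈ C₂, x ∈ e) → (∃ y, (Literature.Probability.LatticeModels.discreteDomainGraph R.carrier δ).Adj x y) → x ∈ Literature.Probability.LatticeModels.discreteArc R.carrier δ (R.arc 2)) ∧ (∀ x : Literature.Probability.LatticeModels.Site 2, (∃ e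 ∈ C₀, x ∈ e) → ¬ ∃ e ∈ C₂, x ∈ e) ∧ (∀ x ∈ Literature.Probability.LatticeModels.DiscreteRect.blackVerts E d₀ n 0, ∀ e ∈ E, x ∈ e → e ∈ C₀) ∧ (∀ y ∈ Literature.Probability.LatticeModels.DiscreteRect.blackVerts E d₀ n 2, ∀ e ∈ E, y ∈ e → e ∈ C₂)) → ∀ (R : Literature.Probability.RandomPlanarGeometry.ConformalRectangle) (φ : Literature.Probability.RandomPlanarGeometry.ConformalEquiv UpperHalfPlane.upperHalfPlaneSet R.carrier) (x : Fin 4 → ℝ), R.IsUniformizing φ x → ∀ κ : ℝ, 0 < κ → ∀ᶠ δ in nhdsWithin (0 : ℝ) (Set.Ioi 0), Literature.Probability.LatticeModels.fkIsingCrossingFunction (Literature.Probability.RandomPlanarGeometry.crossRatio x) - κ < Polynomial.aeval (Real.sqrt 2) (Literature.Probability.LatticeModels.fkTwoArcCrossingPolynomial R δ Literature.Probability.LatticeModels.ArcWiring.joint) / (Polynomial.aeval (Real.sqrt 2) (Literature.Probability.LatticeModels.fkTwoArcCrossingPolynomial R δ Literature.Probability.LatticeModels.ArcWiring.joint) + Real.sqrt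 2 * (Polynomial.aeval (Real.sqrt 2) (Literature.Probability.LatticeModels.fkTwoArcPartitionPolynomials R δ Literature.Probability.LatticeModels.ArcWiring.joint) - Polynomial.aeval (Real.sqrt 2) (Literature.Probability.LatticeModels.fkTwoArcCrossingPolynomial R δ Literature.Probability.LatticeModels.ArcWiring.joint))))

/-- Stub `Prop` 2 — existence of the higher jets (registered stub `stub_higherJetLimitsExist`). -/
def stub_higherJetLimitsExist : Prop :=
  let w : Literature.Probability.RandomPlanarGeometry.ConformalRectangle → ℝ → ℂ → Set (Sym2 (Literature.Probability.LatticeModels.Site 2)) → ℂ := fun R δ s ω ↦ s ^ (ω.ncard + 2 * Nat.card ((Literature.Probability.Percolation.openGraph ω ⊔ Literature.Probability.LatticeModels.wired (Literature.Probability.LatticeModels.discreteArc R.carrier δ (R.arc 0) ∪ Literature.Probability.LatticeModels.discreteArc R.carrier δ (R.arc 2))).induce (Literature.Probability.LatticeModels.meshDomain R.carrier δ)).ConnectedComponent); let P : Literature.Probability.RandomPlanarGeometry.ConformalRectangle → ℝ → ℂ → ℂ := fun R δ s ↦ (∑ᶠ ω ∈ 𝒫 (Literature.Probability.LatticeModels.discreteDomainGraph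 R.carrier δ).edgeSet, (Literature.Probability.Percolation.discreteCrossing R.carrier δ (R.arc 0) (R.arc 2)).indicator (w R δ s) ω) / (∑ᶠ ω ∈ 𝒫 (Literature.Probability.LatticeModels.discreteDomainGraph R.carrier δ).edgeSet, w R δ s ω); ∀ n : ℕ, 1 ≤ n → ∀ R : Literature.Probability.RandomPlanarGeometry.ConformalRectangle, ∃ L : ℂ, Filter.Tendsto (fun δ ↦ iteratedDeriv n (P R δ) (Real.sqrt 2 : ℂ)) (nhdsWithin 0 (Set.Ioi 0)) (nhds L)

/-- Stub `Prop` 3a — marked equivalence from equal cross-ratio and equal orientation (registered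
sub-goal `stub_higherJetLimitsConformal_markedEquivalence`, PROVED by worker B). -/
def stub_higherJetLimitsConformal_markedEquivalence : Prop :=
  ∀ (R R' : Literature.Probability.RandomPlanarGeometry.ConformalRectangle) (φ : Literature.Probability.RandomPlanarGeometry.ConformalEquiv UpperHalfPlane.upperHalfPlaneSet R.carrier) (x : Fin 4 → ℝ) (φ' : Literature.Probability.RandomPlanarGeometry.ConformalEquiv UpperHalfPlane.upperHalfPlaneSet R'.carrier) (x' : Fin 4 → ℝ), R.IsUniformizing φ x → R'.IsUniformizing φ' x' → (StrictMono x ↔ StrictMono x') → Literature.Probability.RandomPlanarGeometry.crossRatio x = Literature.Probability.RandomPlanarGeometry.crossRatio x' → ∃ Ψ : Literature.Probability.RandomPlanarGeometry.ConformalEquiv R.carrier R'.carrier, ∀ i : Fin 4, Ψ.HasBoundaryValue (R.pt i) (R'.pt i)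

/-- Stub `Prop` 3b — conformal covariance of the higher jet limits under conformal equivalences of
marked rectangles (registered stub `stub_higherJetCovariance`; NEW mathematics). -/
def stub_higherJetCovariance : Prop :=
  let w : Literature.Probability.RandomPlanarGeometry.ConformalRectangle → ℝ → ℂ → Set (Sym2 (Literature.Probability.LatticeModels.Site 2)) → ℂ := fun R δ s ω ↦ s ^ (ω.ncard + 2 * Nat.card ((Literature.Probability.Percolation.openGraph ω ⊔ Literature.Probability.LatticeModels.wired (Literature.Probability.LatticeModels.discreteArc R.carrier δ (R.arc 0) ∪ Literature.Probability.LatticeModels.discreteArc R.carrier δ (R.arc 2))).induce (Literature.Probability.LatticeModels.meshDomain R.carrier δ)).ConnectedComponent); let P : Literature.Probability.RandomPlanarGeometry.ConformalRectangle → ℝ → ℂ → ℂ := fun R δ s ↦ (∑ᶠ ω ∈ 𝒫 (Literature.Probability.LatticeModels.discreteDomainGraph R.carrier δ).edgeSet, (Literature.Probability.Percolation.discreteCrossing R.carrier δ (R.arc 0) (R.arc 2)).indicator (w R δ s) ω) / (∑ᶠ ω ∈ 𝒫 (Literature.Probability.LatticeModels.discreteDomainGraph R.carrier δ).edgeSet,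 w R δ s ω); ∀ n : ℕ, 1 ≤ n → ∀ (R R' : Literature.Probability.RandomPlanarGeometry.ConformalRectangle) (Ψ : Literature.Probability.RandomPlanarGeometry.ConformalEquiv R.carrier R'.carrier), (∀ i : Fin 4, Ψ.HasBoundaryValue (R.pt i) (R'.pt i)) → ∀ (L L' : ℂ), Filter.Tendsto (fun δ ↦ iteratedDeriv n (P R δ) (Real.sqrt 2 : ℂ)) (nhdsWithin 0 (Set.Ioi 0)) (nhds L) → Filter.Tendsto (fun δ ↦ iteratedDeriv n (P R' δ) (Real.sqrt 2 : ℂ)) (nhdsWithin 0 (Set.Ioi 0)) (nhds L') → L = L'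

/-- Stub `Prop` 3c — exact mirror symmetry of the crossing ratio (registered stub
`stub_mirrorCrossingRatio`; an equivariance of the discretisation, provable now). -/
def stub_mirrorCrossingRatio : Prop :=
  let w : Literature.Probability.RandomPlanarGeometry.ConformalRectangle → ℝ → ℂ → Set (Sym2 (Literature.Probability.LatticeModels.Site 2)) → ℂ := fun R δ s ω ↦ s ^ (ω.ncard + 2 * Nat.card ((Literature.Probability.Percolation.openGraph ω ⊔ Literature.Probability.LatticeModels.wired (Literature.Probability.LatticeModels.discreteArc R.carrier δ (R.arc 0) ∪ Literature.Probability.LatticeModels.discreteArc R.carrier δ (R.arc 2))).induce (Literature.Probability.LatticeModels.meshDomain R.carrier δ)).ConnectedComponent); let P : Literature.Probability.RandomPlanarGeometry.ConformalRectangle → ℝ → ℂ → ℂ := fun R δ s ↦ (∑ᶠ ω ∈ 𝒫 (Literature.Probability.LatticeModels.discreteDomainGraph R.carrier δ).edgeSet, (Literature.Probability.Percolation.discreteCrossing R.carrier δ (R.arc 0) (R.arc 2)).indicator (w R δ s) ω) / (∑ᶠ ω ∈ 𝒫 (Literature.Probability.LatticeModels.discreteDomainGraph R.carrier δ).edgeSet,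 w R δ s ω); ∀ (R : Literature.Probability.RandomPlanarGeometry.ConformalRectangle) (δ : ℝ), 0 < δ → ∀ s : ℂ, P R.conjugate δ s = P R δ s

end Stubs

/-! ### The registered stubs (the ONLY sorries of the file: 0, G1 = `stub_design_meshQuad`, 2, 3b; 1, 1′, DESIGN± are derived) -/

/-- stub 0 (reshape 2): the named fact `ChelkakSmirnov2012_fkIsingQuadrilateralCrossing` (Chelkak–Smirnov
2012 Thm 6.1, square lattice, uniform form) — an obligation of the line because the crux is
unconditional; to be discharged by a Literature `…_holds` theorem (XL, in print). -/
theorem stub_chelkakSmirnovQuadrilateralCrossing :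
    Literature.Probability.LatticeModels.ChelkakSmirnov2012_fkIsingQuadrilateralCrossing := by
  sorry

/-- sub-goal G1 (wave 5): registered stub `stub_design_meshQuad` — the Chelkak–Smirnov presentation of the polyomino
of a ccw rectilinear polygon at small mesh, `csDomain` as a Jordan domain `O(δ)`-close to the polygon, black/white
vertex localisation. OPEN (XL; worker landing tetrakis-triangulation parts: …StubDesignMeshQuadPart1/Part2/Comb). -/
theorem stub_design_meshQuad :
    (∀ (Rp : Literature.Probability.RandomPlanarGeometry.ConformalRectangle) (l : List ℂ) (h : Literature.Probability.RandomPlanarGeometry.IsSimpleClosedPolygon l) (ρ : ℝ → ℝ), (∀ (k : ℕ) (hk : k < l.length), (l[k]).re = (l[(k + 1) % l.length]'(Nat.mod_lt _ h.pos)).re ∨ (l[k]).im = (l[(k + 1) % l.length]'(Nat.mod_lt _ h.pos)).im) → Continuous ρ → StrictMono ρ → Function.Surjective ρ → (∀ s : ℝ, ρ (s + 1) = ρ s + 1) → Rp.boundary = Literature.Probability.RandomPlanarGeometry.polygonLoop l ∘ ρ → Rp.carrier = (Literature.Probability.RandomPlanarGeometry.polygonDomain l h).carrier → (∀ (k : ℕ)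 (hk : k < l.length) (θ : ℝ), θ ∈ Set.Ioo (0 : ℝ) 1 → ∀ᶠ s : ℝ in nhdsWithin (0 : ℝ) (Set.Ioi 0), Literature.Probability.RandomPlanarGeometry.polygonLoop l ((k + θ) / l.length) + (s : ℂ) * (Complex.I * (l[(k + 1) % l.length]'(Nat.mod_lt _ h.pos) - l[k])) ∈ Rp.carrier) → ∃ C : ℝ, ∀ᶠ δ in nhdsWithin (0 : ℝ) (Set.Ioi 0), ∃ (E : Finset (Sym2 (Literature.Probability.LatticeModels.Site 2))) (d₀ : Literature.Probability.LatticeModels.Site 2 × Fin 4) (n : Fin 4 → ℕ) (Q : Literature.Probability.RandomPlanarGeometry.ConformalRectangle), (Literature.Probability.LatticeModels.DiscreteRect.IsCSQuadrilateral E d₀ n ∧ Literature.Probability.LatticeModels.DiscreteRect.csDomain E d₀ n δ = Q.carrier ∧ (∀ j : Fin 4, Q.pt j = Literature.Probability.LatticeModels.meshPoint δ (Literature.Probability.LatticeModels.DiscreteRect.csCorner E d₀ n j)) ∧ Q.arc 0 ⊆ Literature.Probability.LatticeModels.DiscreteRect.blackArc E d₀ n δ 0 ∧ Q.arc 2 ⊆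 Literature.Probability.LatticeModels.DiscreteRect.blackArc E d₀ n δ 2 ∧ (∀ t : ℝ, dist (Q.boundary t) (Rp.boundary t) ≤ C * δ) ∧ (∀ j : Fin 4, dist (Q.pt j) (Rp.pt j) ≤ C * δ)) ∧ (∀ e, e ∈ E ↔ ∃ s : Literature.Probability.LatticeModels.Site 2, Literature.Probability.LatticeModels.DiscreteRect.closedSq δ s ⊆ closure Rp.carrier ∧ ∃ j : Fin 4, e = s(Literature.Probability.LatticeModels.DiscreteRect.corner s j, Literature.Probability.LatticeModels.DiscreteRect.corner s j + Literature.Probability.LatticeModels.DiscreteRect.dir j)) ∧ (∀ x ∈ Literature.Probability.LatticeModels.DiscreteRect.blackVerts E d₀ n 0, Metric.infDist (Literature.Probability.LatticeModels.meshPoint δ x) (Rp.arc 0) ≤ C * δ) ∧ (∀ x ∈ Literature.Probability.LatticeModels.DiscreteRect.blackVerts E d₀ n 2, Metric.infDist (Literature.Probability.LatticeModels.meshPoint δ x) (Rp.arc 2) ≤ C * δ) ∧ (∀ x ∈ Literature.Probability.LatticeModels.DiscreteRect.verts E, (∃ k : Fin 4, s(x, x + Literature.Probability.LatticeModels.DiscreteRect.dir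 k) ∉ E) → x ∈ Literature.Probability.LatticeModels.DiscreteRect.blackVerts E d₀ n 0 ∪ Literature.Probability.LatticeModels.DiscreteRect.blackVerts E d₀ n 2 ∨ Metric.infDist (Literature.Probability.LatticeModels.meshPoint δ x) (Rp.arc 1 ∪ Rp.arc 3) ≤ C * δ)) := by
  sorry

/-- DESIGN⁺ (reshape 4): the former stub `stub_design_upper`, now DERIVED from G1 (`Stubs.stub_design_meshQuad`, open) and the
landed wave-5 pieces G_E p171364, E⁺ p171507, G0 p170944, D1e⁺ p170821; see `Lines/birth-n0-bridge-c3.md` §13. No sorry here. -/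
theorem design_upper_of (hG : Stubs.stub_design_meshQuad) :
    (∀ (R : Literature.Probability.RandomPlanarGeometry.ConformalRectangle) (τ : ℝ), 0 < τ → ∃ (Rp : Literature.Probability.RandomPlanarGeometry.ConformalRectangle) (C : ℝ), (∀ (φ : Literature.Probability.RandomPlanarGeometry.ConformalEquiv UpperHalfPlane.upperHalfPlaneSet R.carrier) (x : Fin 4 → ℝ), R.IsUniformizing φ x → ∀ (φ' : Literature.Probability.RandomPlanarGeometry.ConformalEquiv UpperHalfPlane.upperHalfPlaneSet Rp.carrier) (x' : Fin 4 → ℝ), Rp.IsUniformizing φ' x' → |Literature.Probability.RandomPlanarGeometry.crossRatio x' - Literature.Probability.RandomPlanarGeometry.crossRatio x| < τ) ∧ ∀ᶠ δ in nhdsWithin (0 : ℝ) (Set.Ioi 0), ∃ (E : Finset (Sym2 (Literature.Probability.LatticeModels.Site 2))) (d₀ : Literature.Probability.LatticeModels.Site 2 × Fin 4) (n : Fin 4 → ℕ) (Q : Literature.Probability.RandomPlanarGeometry.ConformalRectangle) (Z₀ Z₂ : Set (Literature.Probability.LatticeModels.Site 2)), Literature.Probability.LatticeModels.DiscreteRect.IsCSQuadrilateral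 E d₀ n ∧ Literature.Probability.LatticeModels.DiscreteRect.csDomain E d₀ n δ = Q.carrier ∧ (∀ j : Fin 4, Q.pt j = Literature.Probability.LatticeModels.meshPoint δ (Literature.Probability.LatticeModels.DiscreteRect.csCorner E d₀ n j)) ∧ Q.arc 0 ⊆ Literature.Probability.LatticeModels.DiscreteRect.blackArc E d₀ n δ 0 ∧ Q.arc 2 ⊆ Literature.Probability.LatticeModels.DiscreteRect.blackArc E d₀ n δ 2 ∧ (∀ t : ℝ, dist (Q.boundary t) (Rp.boundary t) ≤ C * δ) ∧ (∀ j : Fin 4, dist (Q.pt j) (Rp.pt j) ≤ C * δ) ∧ Disjoint Z₀ Z₂ ∧ Literature.Probability.LatticeModels.discreteArc R.carrier δ (R.arc 0) ⊆ Z₀ ∧ Literature.Probability.LatticeModels.discreteArc R.carrier δ (R.arc 2) ⊆ Z₂ ∧ Literature.Probability.LatticeModels.DiscreteRect.blackVerts E d₀ n 0 ⊆ Z₀ ∧ Literature.Probability.LatticeModels.DiscreteRect.blackVerts E d₀ n 2 ⊆ Z₂ ∧ (∀ x ∈ Z₀, ∀ y ∈ Z₂, ¬ (Literature.Probability.LatticeModels.discreteDomainGraph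 R.carrier δ).Adj x y ∧ s(x, y) ∉ E) ∧ (∀ v ∈ Z₀ ∪ Z₂, v ∈ (Literature.Probability.LatticeModels.DiscreteRect.verts E : Set (Literature.Probability.LatticeModels.Site 2)) → v ∈ Literature.Probability.LatticeModels.DiscreteRect.blackVerts E d₀ n 0 ∪ Literature.Probability.LatticeModels.DiscreteRect.blackVerts E d₀ n 2) ∧ (∀ v, v ∈ Literature.Probability.LatticeModels.meshDomain R.carrier δ ∪ (Literature.Probability.LatticeModels.DiscreteRect.verts E : Set (Literature.Probability.LatticeModels.Site 2)) → v ∉ Z₀ ∪ Z₂ → v ∈ (Literature.Probability.LatticeModels.DiscreteRect.verts E : Set (Literature.Probability.LatticeModels.Site 2)) ∧ v ∉ Literature.Probability.LatticeModels.DiscreteRect.blackVerts E d₀ n 0 ∪ Literature.Probability.LatticeModels.DiscreteRect.blackVerts E d₀ n 2) ∧ (∀ x y : Literature.Probability.LatticeModels.Site 2, (Literature.Probability.LatticeModels.discreteDomainGraph R.carrier δ).Adj x y → s(x, y) ∉ E → x ∈ Z₀ ∪ Z₂)) := by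
  intro R τ hτ
  have hS := Summit.CriticalPhenomena.CardyFormulaZ2.Theorems.CardyQContinuation.stub_design_squareModel
  obtain ⟨Rp, l, h, ρ, hrect, hρc, hρm, hρs, hρ1, hbd, hcar, hidx, hU1, hU3, hU4, hU6⟩ :=
    Summit.CriticalPhenomena.CardyFormulaZ2.Theorems.CardyQContinuation.stub_design_upper_continuum hS R τ hτ
  have hleft := Summit.CriticalPhenomena.CardyFormulaZ2.Theorems.CardyQContinuation.stub_design_leftInterior Rp l h ρ hrect hρc hρm hρs hρ1 hbd hcar hidx
  obtain ⟨C, hG⟩ := hG Rp l h ρ hrect hρc hρm hρs hρ1 hbd hcar hleft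
  have hD := Summit.CriticalPhenomena.CardyFormulaZ2.Theorems.CardyQContinuation.stub_design_upper_gluing R Rp hU3 hU4 hU6 C
  refine ⟨Rp, C, hU1, ?_⟩
  filter_upwards [hG, hD] with δ hGδ hDδ
  obtain ⟨E, d₀, n, Q, ⟨h1, h2, h3, h4, h5, h6, h7⟩, hi, hii0, hii2, hiv⟩ := hGδ
  obtain ⟨Z₀, Z₂, hg⟩ := hDδ E d₀ n hi hii0 hii2 hiv
  exact ⟨E, d₀, n, Q, Z₀, Z₂, h1, h2, h3, h4, h5, h6, h7, hg⟩

/-- DESIGN⁻ (reshape 4): the former stub `stub_design_lower`, DERIVED from G1 (open) and G_E p171364, E⁻ p170882, G0 p170944, D1e⁻ p170616. -/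
theorem design_lower_of (hG : Stubs.stub_design_meshQuad) :
    (∀ (R : Literature.Probability.RandomPlanarGeometry.ConformalRectangle) (τ : ℝ), 0 < τ → ∃ (Rm : Literature.Probability.RandomPlanarGeometry.ConformalRectangle) (C : ℝ), (∀ (φ : Literature.Probability.RandomPlanarGeometry.ConformalEquiv UpperHalfPlane.upperHalfPlaneSet R.carrier) (x : Fin 4 → ℝ), R.IsUniformizing φ x → ∀ (φ' : Literature.Probability.RandomPlanarGeometry.ConformalEquiv UpperHalfPlane.upperHalfPlaneSet Rm.carrier) (x' : Fin 4 → ℝ), Rm.IsUniformizing φ' x' → |Literature.Probability.RandomPlanarGeometry.crossRatio x' - Literature.Probability.RandomPlanarGeometry.crossRatio x| < τ) ∧ ∀ᶠ δ in nhdsWithin (0 : ℝ) (Set.Ioi 0), ∃ (E : Finset (Sym2 (Literature.Probability.LatticeModels.Site 2))) (d₀ : Literature.Probability.LatticeModels.Site 2 × Fin 4) (n : Fin 4 → ℕ) (Q : Literature.Probability.RandomPlanarGeometry.ConformalRectangle) (C₀ C₂ : Set (Sym2 (Literature.Probability.LatticeModels.Site 2))), Literature.Probability.LatticeModels.DiscreteRect.IsCSQuadrilateral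 E d₀ n ∧ Literature.Probability.LatticeModels.DiscreteRect.csDomain E d₀ n δ = Q.carrier ∧ (∀ j : Fin 4, Q.pt j = Literature.Probability.LatticeModels.meshPoint δ (Literature.Probability.LatticeModels.DiscreteRect.csCorner E d₀ n j)) ∧ Q.arc 0 ⊆ Literature.Probability.LatticeModels.DiscreteRect.blackArc E d₀ n δ 0 ∧ Q.arc 2 ⊆ Literature.Probability.LatticeModels.DiscreteRect.blackArc E d₀ n δ 2 ∧ (∀ t : ℝ, dist (Q.boundary t) (Rm.boundary t) ≤ C * δ) ∧ (∀ j : Fin 4, dist (Q.pt j) (Rm.pt j) ≤ C * δ) ∧ Disjoint (Literature.Probability.LatticeModels.DiscreteRect.blackVerts E d₀ n 0) (Literature.Probability.LatticeModels.DiscreteRect.blackVerts E d₀ n 2) ∧ (∀ v ∈ Literature.Probability.LatticeModels.DiscreteRect.blackVerts E d₀ n 0 ∪ Literature.Probability.LatticeModels.DiscreteRect.blackVerts E d₀ n 2, v ∉ Literature.Probability.LatticeModels.meshDomain R.carrier δ) ∧ (∀ e ∈ E, e ∉ (Literature.Probability.LatticeModels.discreteDomainGraph R.carrier δ).edgeSet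 → e ∈ C₀ ∪ C₂) ∧ (∀ x : Literature.Probability.LatticeModels.Site 2, (∃ e ∈ C₀, x ∈ e) → (∃ y, (Literature.Probability.LatticeModels.discreteDomainGraph R.carrier δ).Adj x y) → x ∈ Literature.Probability.LatticeModels.discreteArc R.carrier δ (R.arc 0)) ∧ (∀ x : Literature.Probability.LatticeModels.Site 2, (∃ e ∈ C₂, x ∈ e) → (∃ y, (Literature.Probability.LatticeModels.discreteDomainGraph R.carrier δ).Adj x y) → x ∈ Literature.Probability.LatticeModels.discreteArc R.carrier δ (R.arc 2)) ∧ (∀ x : Literature.Probability.LatticeModels.Site 2, (∃ e ∈ C₀, x ∈ e) → ¬ ∃ e ∈ C₂, x ∈ e) ∧ (∀ x ∈ Literature.Probability.LatticeModels.DiscreteRect.blackVerts E d₀ n 0, ∀ e ∈ E, x ∈ e → e ∈ C₀) ∧ (∀ y ∈ Literature.Probability.LatticeModels.DiscreteRect.blackVerts E d₀ n 2, ∀ e ∈ E, y ∈ e → e ∈ C₂)) := by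
  intro R τ hτ
  have hS := Summit.CriticalPhenomena.CardyFormulaZ2.Theorems.CardyQContinuation.stub_design_squareModel
  obtain ⟨Rm, l, h, ρ, hrect, hρc, hρm, hρs, hρ1, hbd, hcar, hidx, hL1, hL3, hL5, hL67⟩ :=
    Summit.CriticalPhenomena.CardyFormulaZ2.Theorems.CardyQContinuation.stub_design_lower_continuum hS R τ hτ
  have hleft := Summit.CriticalPhenomena.CardyFormulaZ2.Theorems.CardyQContinuation.stub_design_leftInterior Rm l h ρ hrect hρc hρm hρs hρ1 hbd hcar hidx
  obtain ⟨C, hG⟩ := hG Rm l h ρ hrect hρc hρm hρs hρ1 hbd hcar hleft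
  have hD := Summit.CriticalPhenomena.CardyFormulaZ2.Theorems.CardyQContinuation.stub_design_lower_gluing R Rm hL3 hL5 hL67 C
  refine ⟨Rm, C, hL1, ?_⟩
  filter_upwards [hG, hD] with δ hGδ hDδ
  obtain ⟨E, d₀, n, Q, ⟨h1, h2, h3, h4, h5, h6, h7⟩, hi, hii0, hii2, hiv⟩ := hGδ
  obtain ⟨C₀, C₂, hg⟩ := hDδ E d₀ n hi hii0 hii2
  exact ⟨E, d₀, n, Q, C₀, C₂, h1, h2, h3, h4, h5, h6, h7, hg⟩

/-- sub-goal H⁺ (reshape 3): CLOSED — landed p168525 as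
`Theorems/CardyQContinuationIsingJetsConformalStubAssemblyUpper.lean` (from normalForms / upperComparison /
csLimitAlongSequence / harmonicMeasureAlongSequence), imported here. -/
theorem stub_loopSymmetricLimit_assemblyUpper :
    (Literature.Probability.LatticeModels.ChelkakSmirnov2012_fkIsingQuadrilateralCrossing → (∀ (R : Literature.Probability.RandomPlanarGeometry.ConformalRectangle) (τ : ℝ), 0 < τ → ∃ (Rp : Literature.Probability.RandomPlanarGeometry.ConformalRectangle) (C : ℝ), (∀ (φ : Literature.Probability.RandomPlanarGeometry.ConformalEquiv UpperHalfPlane.upperHalfPlaneSet R.carrier) (x : Fin 4 → ℝ), R.IsUniformizing φ x → ∀ (φ' : Literature.Probability.RandomPlanarGeometry.ConformalEquiv UpperHalfPlane.upperHalfPlaneSet Rp.carrier) (x' : Fin 4 → ℝ), Rp.IsUniformizing φ' x' → |Literature.Probability.RandomPlanarGeometry.crossRatio x' - Literature.Probability.RandomPlanarGeometry.crossRatio x| < τ) ∧ ∀ᶠ δ in nhdsWithin (0 : ℝ) (Set.Ioi 0), ∃ (E : Finset (Sym2 (Literature.Probability.LatticeModels.Site 2))) (d₀ : Literature.Probability.LatticeModels.Site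 2 × Fin 4) (n : Fin 4 → ℕ) (Q : Literature.Probability.RandomPlanarGeometry.ConformalRectangle) (Z₀ Z₂ : Set (Literature.Probability.LatticeModels.Site 2)), Literature.Probability.LatticeModels.DiscreteRect.IsCSQuadrilateral E d₀ n ∧ Literature.Probability.LatticeModels.DiscreteRect.csDomain E d₀ n δ = Q.carrier ∧ (∀ j : Fin 4, Q.pt j = Literature.Probability.LatticeModels.meshPoint δ (Literature.Probability.LatticeModels.DiscreteRect.csCorner E d₀ n j)) ∧ Q.arc 0 ⊆ Literature.Probability.LatticeModels.DiscreteRect.blackArc E d₀ n δ 0 ∧ Q.arc 2 ⊆ Literature.Probability.LatticeModels.DiscreteRect.blackArc E d₀ n δ 2 ∧ (∀ t : ℝ, dist (Q.boundary t) (Rp.boundary t) ≤ C * δ) ∧ (∀ j : Fin 4, dist (Q.pt j) (Rp.pt j) ≤ C * δ) ∧ Disjoint Z₀ Z₂ ∧ Literature.Probability.LatticeModels.discreteArc R.carrier δ (R.arc 0) ⊆ Z₀ ∧ Literature.Probability.LatticeModels.discreteArc R.carrier δ (R.arc 2) ⊆ Z₂ ∧ Literature.Probability.LatticeModels.DiscreteRect.blackVerts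 E d₀ n 0 ⊆ Z₀ ∧ Literature.Probability.LatticeModels.DiscreteRect.blackVerts E d₀ n 2 ⊆ Z₂ ∧ (∀ x ∈ Z₀, ∀ y ∈ Z₂, ¬ (Literature.Probability.LatticeModels.discreteDomainGraph R.carrier δ).Adj x y ∧ s(x, y) ∉ E) ∧ (∀ v ∈ Z₀ ∪ Z₂, v ∈ (Literature.Probability.LatticeModels.DiscreteRect.verts E : Set (Literature.Probability.LatticeModels.Site 2)) → v ∈ Literature.Probability.LatticeModels.DiscreteRect.blackVerts E d₀ n 0 ∪ Literature.Probability.LatticeModels.DiscreteRect.blackVerts E d₀ n 2) ∧ (∀ v, v ∈ Literature.Probability.LatticeModels.meshDomain R.carrier δ ∪ (Literature.Probability.LatticeModels.DiscreteRect.verts E : Set (Literature.Probability.LatticeModels.Site 2)) → v ∉ Z₀ ∪ Z₂ → v ∈ (Literature.Probability.LatticeModels.DiscreteRect.verts E : Set (Literature.Probability.LatticeModels.Site 2)) ∧ v ∉ Literature.Probability.LatticeModels.DiscreteRect.blackVerts E d₀ n 0 ∪ Literature.Probability.LatticeModels.DiscreteRect.blackVerts E d₀ n 2) ∧ (∀ x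 y : Literature.Probability.LatticeModels.Site 2, (Literature.Probability.LatticeModels.discreteDomainGraph R.carrier δ).Adj x y → s(x, y) ∉ E → x ∈ Z₀ ∪ Z₂)) → ∀ (R : Literature.Probability.RandomPlanarGeometry.ConformalRectangle) (φ : Literature.Probability.RandomPlanarGeometry.ConformalEquiv UpperHalfPlane.upperHalfPlaneSet R.carrier) (x : Fin 4 → ℝ), R.IsUniformizing φ x → ∀ κ : ℝ, 0 < κ → ∀ᶠ δ in nhdsWithin (0 : ℝ) (Set.Ioi 0), Polynomial.aeval (Real.sqrt 2) (Literature.Probability.LatticeModels.fkTwoArcCrossingPolynomial R δ Literature.Probability.LatticeModels.ArcWiring.joint) / (Polynomial.aeval (Real.sqrt 2) (Literature.Probability.LatticeModels.fkTwoArcCrossingPolynomial R δ Literature.Probability.LatticeModels.ArcWiring.joint) + Real.sqrt 2 * (Polynomial.aeval (Real.sqrt 2) (Literature.Probability.LatticeModels.fkTwoArcPartitionPolynomials R δ Literature.Probability.LatticeModels.ArcWiring.joint) - Polynomial.aeval (Real.sqrt 2) (Literature.Probability.LatticeModels.fkTwoArcCrossingPolynomial R δ Literature.Probability.LatticeModels.ArcWiring.joint)))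 < Literature.Probability.LatticeModels.fkIsingCrossingFunction (Literature.Probability.RandomPlanarGeometry.crossRatio x) + κ) :=
  Summit.CriticalPhenomena.CardyFormulaZ2.Theorems.CardyQContinuation.stub_loopSymmetricLimit_assemblyUpper

/-- sub-goal H⁻ (reshape 3): CLOSED — landed as `Theorems/CardyQContinuationIsingJetsConformalStubAssemblyLower.lean`,
imported here. -/
theorem stub_loopSymmetricLimit_assemblyLower :
    (Literature.Probability.LatticeModels.ChelkakSmirnov2012_fkIsingQuadrilateralCrossing → (∀ (R : Literature.Probability.RandomPlanarGeometry.ConformalRectangle) (τ : ℝ), 0 < τ → ∃ (Rm : Literature.Probability.RandomPlanarGeometry.ConformalRectangle) (C : ℝ), (∀ (φ : Literature.Probability.RandomPlanarGeometry.ConformalEquiv UpperHalfPlane.upperHalfPlaneSet R.carrier) (x : Fin 4 → ℝ), R.IsUniformizing φ x → ∀ (φ' : Literature.Probability.RandomPlanarGeometry.ConformalEquiv UpperHalfPlane.upperHalfPlaneSet Rm.carrier) (x' : Fin 4 → ℝ), Rm.IsUniformizing φ' x' → |Literature.Probability.RandomPlanarGeometry.crossRatio x' - Literature.Probability.RandomPlanarGeometry.crossRatio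 x| < τ) ∧ ∀ᶠ δ in nhdsWithin (0 : ℝ) (Set.Ioi 0), ∃ (E : Finset (Sym2 (Literature.Probability.LatticeModels.Site 2))) (d₀ : Literature.Probability.LatticeModels.Site 2 × Fin 4) (n : Fin 4 → ℕ) (Q : Literature.Probability.RandomPlanarGeometry.ConformalRectangle) (C₀ C₂ : Set (Sym2 (Literature.Probability.LatticeModels.Site 2))), Literature.Probability.LatticeModels.DiscreteRect.IsCSQuadrilateral E d₀ n ∧ Literature.Probability.LatticeModels.DiscreteRect.csDomain E d₀ n δ = Q.carrier ∧ (∀ j : Fin 4, Q.pt j = Literature.Probability.LatticeModels.meshPoint δ (Literature.Probability.LatticeModels.DiscreteRect.csCorner E d₀ n j)) ∧ Q.arc 0 ⊆ Literature.Probability.LatticeModels.DiscreteRect.blackArc E d₀ n δ 0 ∧ Q.arc 2 ⊆ Literature.Probability.LatticeModels.DiscreteRect.blackArc E d₀ n δ 2 ∧ (∀ t : ℝ, dist (Q.boundary t) (Rm.boundary t) ≤ C * δ) ∧ (∀ j : Fin 4, dist (Q.pt j) (Rm.pt j) ≤ C * δ) ∧ Disjoint (Literature.Probability.LatticeModels.DiscreteRect.blackVerts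 E d₀ n 0) (Literature.Probability.LatticeModels.DiscreteRect.blackVerts E d₀ n 2) ∧ (∀ v ∈ Literature.Probability.LatticeModels.DiscreteRect.blackVerts E d₀ n 0 ∪ Literature.Probability.LatticeModels.DiscreteRect.blackVerts E d₀ n 2, v ∉ Literature.Probability.LatticeModels.meshDomain R.carrier δ) ∧ (∀ e ∈ E, e ∉ (Literature.Probability.LatticeModels.discreteDomainGraph R.carrier δ).edgeSet → e ∈ C₀ ∪ C₂) ∧ (∀ x : Literature.Probability.LatticeModels.Site 2, (∃ e ∈ C₀, x ∈ e) → (∃ y, (Literature.Probability.LatticeModels.discreteDomainGraph R.carrier δ).Adj x y) → x ∈ Literature.Probability.LatticeModels.discreteArc R.carrier δ (R.arc 0)) ∧ (∀ x : Literature.Probability.LatticeModels.Site 2, (∃ e ∈ C₂, x ∈ e) → (∃ y, (Literature.Probability.LatticeModels.discreteDomainGraph R.carrier δ).Adj x y) → x ∈ Literature.Probability.LatticeModels.discreteArc R.carrier δ (R.arc 2)) ∧ (∀ x : Literature.Probability.LatticeModels.Site 2, (∃ e ∈ C₀, x ∈ e) → ¬ ∃ e ∈ C₂, x ∈ e) ∧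 (∀ x ∈ Literature.Probability.LatticeModels.DiscreteRect.blackVerts E d₀ n 0, ∀ e ∈ E, x ∈ e → e ∈ C₀) ∧ (∀ y ∈ Literature.Probability.LatticeModels.DiscreteRect.blackVerts E d₀ n 2, ∀ e ∈ E, y ∈ e → e ∈ C₂)) → ∀ (R : Literature.Probability.RandomPlanarGeometry.ConformalRectangle) (φ : Literature.Probability.RandomPlanarGeometry.ConformalEquiv UpperHalfPlane.upperHalfPlaneSet R.carrier) (x : Fin 4 → ℝ), R.IsUniformizing φ x → ∀ κ : ℝ, 0 < κ → ∀ᶠ δ in nhdsWithin (0 : ℝ) (Set.Ioi 0), Literature.Probability.LatticeModels.fkIsingCrossingFunction (Literature.Probability.RandomPlanarGeometry.crossRatio x) - κ < Polynomial.aeval (Real.sqrt 2) (Literature.Probability.LatticeModels.fkTwoArcCrossingPolynomial R δ Literature.Probability.LatticeModels.ArcWiring.joint) / (Polynomial.aeval (Real.sqrt 2) (Literature.Probability.LatticeModels.fkTwoArcCrossingPolynomial R δ Literature.Probability.LatticeModels.ArcWiring.joint) + Real.sqrt 2 * (Polynomial.aeval (Real.sqrt 2) (Literature.Probability.LatticeModels.fkTwoArcPartitionPolynomials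 R δ Literature.Probability.LatticeModels.ArcWiring.joint) - Polynomial.aeval (Real.sqrt 2) (Literature.Probability.LatticeModels.fkTwoArcCrossingPolynomial R δ Literature.Probability.LatticeModels.ArcWiring.joint)))) :=
  Summit.CriticalPhenomena.CardyFormulaZ2.Theorems.CardyQContinuation.stub_loopSymmetricLimit_assemblyLower

/-- stub 1′ (the n = 0 bridge) DERIVED (reshape 3, lead c3): `CS-fact → H_LS` with `c := fkIsingCrossingFunction`,
from DESIGN⁺, DESIGN⁻ and the two assembly sub-goals (`limsup ≤ p η` and `liminf ≥ p η` give the limit). -/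
theorem loopSymmetricLimit_of_chelkakSmirnov_of (hDp : Stubs.stub_design_upper) (hDm : Stubs.stub_design_lower)
    (hAp : Stubs.stub_assembly_upper) (hAm : Stubs.stub_assembly_lower) :
    Stubs.stub_loopSymmetricLimit_of_chelkakSmirnov := by
  unfold Stubs.stub_loopSymmetricLimit_of_chelkakSmirnov
  unfold Stubs.stub_assembly_upper at hAp
  unfold Stubs.stub_assembly_lower at hAm
  unfold Stubs.stub_design_upper at hDp
  unfold Stubs.stub_design_lower at hDm
  intro hCS
  refine ⟨Literature.Probability.LatticeModels.fkIsingCrossingFunction, fun R φ x hU ↦ ?_⟩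
  rw [Metric.tendsto_nhds]
  intro κ hκ
  filter_upwards [hAp hCS hDp R φ x hU κ hκ, hAm hCS hDm R φ x hU κ hκ] with δ h1 h2
  rw [Real.dist_eq, abs_sub_lt_iff]
  exact ⟨by linarith, by linarith⟩

/-- stub 1 (JetsZero) DERIVED, conditionally on the named fact: `CS-fact → stub 1`, from the bridge
stub 1′ and the landed `stub_isingCrossingConformal_of_loopSymmetricLimit` (p148640). -/
theorem isingCrossingConformal_of
    (hCS : Stubs.stub_chelkakSmirnovQuadrilateralCrossing)
    (hB : Stubs.stub_loopSymmetricLimit_of_chelkakSmirnov) : Stubs.stub_isingCrossingConformal :=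
  Summit.CriticalPhenomena.CardyFormulaZ2.Theorems.CardyQContinuation.stub_isingCrossingConformal_of_loopSymmetricLimit
    (hB hCS)


/-- stub 2 (existence of the higher Ising jets, per rectangle; n = 1 is `FirstJetConverges`): for
`n ≥ 1` and every conformal rectangle the `n`-th `s`-derivative of `P_δ` at `s = √2` converges as
`δ → 0⁺`. -/
theorem stub_higherJetLimitsExist :
    (let w : Literature.Probability.RandomPlanarGeometry.ConformalRectangle → ℝ → ℂ → Set (Sym2 (Literature.Probability.LatticeModels.Site 2)) → ℂ := fun R δ s ω ↦ s ^ (ω.ncard + 2 * Nat.card ((Literature.Probability.Percolation.openGraph ω ⊔ Literature.Probability.LatticeModels.wired (Literature.Probability.LatticeModels.discreteArc R.carrier δ (R.arc 0) ∪ Literature.Probability.LatticeModels.discreteArc R.carrier δ (R.arc 2))).induce (Literature.Probability.LatticeModels.meshDomain R.carrier δ)).ConnectedComponent); let P : Literature.Probability.RandomPlanarGeometry.ConformalRectangle → ℝ → ℂ → ℂ := fun R δ s ↦ (∑ᶠ ω ∈ 𝒫 (Literature.Probability.LatticeModels.discreteDomainGraph R.carrier δ).edgeSet, (Literature.Probability.Percolation.discreteCrossing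 R.carrier δ (R.arc 0) (R.arc 2)).indicator (w R δ s) ω) / (∑ᶠ ω ∈ 𝒫 (Literature.Probability.LatticeModels.discreteDomainGraph R.carrier δ).edgeSet, w R δ s ω); ∀ n : ℕ, 1 ≤ n → ∀ R : Literature.Probability.RandomPlanarGeometry.ConformalRectangle, ∃ L : ℂ, Filter.Tendsto (fun δ ↦ iteratedDeriv n (P R δ) (Real.sqrt 2 : ℂ)) (nhdsWithin 0 (Set.Ioi 0)) (nhds L)) := by
  sorry

/-- stub 3a (marked equivalence; PROVED in
`Theorems/CardyQContinuationIsingJetsConformalStubHigherJetLimitsConformal.lean`, kept as a stub only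
until that file is in the tree): conformal rectangles with uniformizing data of equal orientation and
equal cross-ratio are conformally equivalent as marked domains. -/
theorem stub_higherJetLimitsConformal_markedEquivalence :
    ∀ (R R' : Literature.Probability.RandomPlanarGeometry.ConformalRectangle) (φ : Literature.Probability.RandomPlanarGeometry.ConformalEquiv UpperHalfPlane.upperHalfPlaneSet R.carrier) (x : Fin 4 → ℝ) (φ' : Literature.Probability.RandomPlanarGeometry.ConformalEquiv UpperHalfPlane.upperHalfPlaneSet R'.carrier) (x' : Fin 4 → ℝ), R.IsUniformizing φ x → R'.IsUniformizing φ' x' → (StrictMono x ↔ StrictMono x') → Literature.Probability.RandomPlanarGeometry.crossRatio x = Literature.Probability.RandomPlanarGeometry.crossRatio x' → ∃ Ψ : Literature.Probability.RandomPlanarGeometry.ConformalEquiv R.carrier R'.carrier, ∀ i : Fin 4, Ψ.HasBoundaryValue (R.pt i) (R'.pt i) :=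
  Summit.CriticalPhenomena.CardyFormulaZ2.Theorems.CardyQContinuation.stub_higherJetLimitsConformal_markedEquivalence

/-- stub 3b (conformal covariance of the higher Ising jets; NEW): for `n ≥ 1`, if `Ψ : Ω → Ω'` is a
conformal equivalence with boundary value `R'.pt i` at `R.pt i` for the four marked points, then the
`δ → 0⁺` limits of the `n`-th jets of `P_δ` at `√2` for `R` and `R'`, when they exist, coincide. -/
theorem stub_higherJetCovariance :
    (let w : Literature.Probability.RandomPlanarGeometry.ConformalRectangle → ℝ → ℂ → Set (Sym2 (Literature.Probability.LatticeModels.Site 2)) → ℂ := fun R δ s ω ↦ s ^ (ω.ncard + 2 * Nat.card ((Literature.Probability.Percolation.openGraph ω ⊔ Literature.Probability.LatticeModels.wired (Literature.Probability.LatticeModels.discreteArc R.carrier δ (R.arc 0) ∪ Literature.Probability.LatticeModels.discreteArc R.carrier δ (R.arc 2))).induce (Literature.Probability.LatticeModels.meshDomain R.carrier δ)).ConnectedComponent); let P : Literature.Probability.RandomPlanarGeometry.ConformalRectangle → ℝ → ℂ → ℂ := fun R δ s ↦ (∑ᶠ ω ∈ 𝒫 (Literature.Probability.LatticeModels.discreteDomainGraph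 R.carrier δ).edgeSet, (Literature.Probability.Percolation.discreteCrossing R.carrier δ (R.arc 0) (R.arc 2)).indicator (w R δ s) ω) / (∑ᶠ ω ∈ 𝒫 (Literature.Probability.LatticeModels.discreteDomainGraph R.carrier δ).edgeSet, w R δ s ω); ∀ n : ℕ, 1 ≤ n → ∀ (R R' : Literature.Probability.RandomPlanarGeometry.ConformalRectangle) (Ψ : Literature.Probability.RandomPlanarGeometry.ConformalEquiv R.carrier R'.carrier), (∀ i : Fin 4, Ψ.HasBoundaryValue (R.pt i) (R'.pt i)) → ∀ (L L' : ℂ), Filter.Tendsto (fun δ ↦ iteratedDeriv n (P R δ) (Real.sqrt 2 : ℂ)) (nhdsWithin 0 (Set.Ioi 0)) (nhds L) → Filter.Tendsto (fun δ ↦ iteratedDeriv n (P R' δ) (Real.sqrt 2 : ℂ)) (nhdsWithin 0 (Set.Ioi 0)) (nhds L') → L = L') := by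
  sorry

/-- stub 3c (mirror symmetry, exact; CLOSED — proved by worker C, landed p145626 as
`Theorems/CardyQContinuationIsingJetsConformalStubMirrorCrossingRatio.lean`, imported here): for every conformal rectangle `R`, every mesh `δ > 0` and every
complex `s`, the crossing ratio of the complex-conjugate rectangle `R* = MarkedDomain.conjugate R`
equals that of `R` (the discretisation and the weights are equivariant under `(x₀,x₁) ↦ (x₀,-x₁)`). -/
theorem stub_mirrorCrossingRatio :
    (let w : Literature.Probability.RandomPlanarGeometry.ConformalRectangle → ℝ → ℂ → Set (Sym2 (Literature.Probability.LatticeModels.Site 2)) → ℂ := fun R δ s ω ↦ s ^ (ω.ncard + 2 * Nat.card ((Literature.Probability.Percolation.openGraph ω ⊔ Literature.Probability.LatticeModels.wired (Literature.Probability.LatticeModels.discreteArc R.carrier δ (R.arc 0) ∪ Literature.Probability.LatticeModels.discreteArc R.carrier δ (R.arc 2))).induce (Literature.Probability.LatticeModels.meshDomain R.carrier δ)).ConnectedComponent); let P : Literature.Probability.RandomPlanarGeometry.ConformalRectangle → ℝ → ℂ → ℂ := fun R δ s ↦ (∑ᶠ ω ∈ 𝒫 (Literature.Probability.LatticeModels.discreteDomainGraph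 R.carrier δ).edgeSet, (Literature.Probability.Percolation.discreteCrossing R.carrier δ (R.arc 0) (R.arc 2)).indicator (w R δ s) ω) / (∑ᶠ ω ∈ 𝒫 (Literature.Probability.LatticeModels.discreteDomainGraph R.carrier δ).edgeSet, w R δ s ω); ∀ (R : Literature.Probability.RandomPlanarGeometry.ConformalRectangle) (δ : ℝ), 0 < δ → ∀ s : ℂ, P R.conjugate δ s = P R δ s) :=
  Summit.CriticalPhenomena.CardyFormulaZ2.Theorems.CardyQContinuation.stub_mirrorCrossingRatio

/-! ### Composition (sorry-free) -/

/-- **The planner's third stub, derived**: for `n ≥ 1`, jet limits of two conformal rectangles whose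
uniformizing data have the same cross-ratio coincide — from marked equivalence (3a), covariance (3b)
and the mirror symmetry (3c). Same orientation: 3a gives `Ψ`, 3b concludes. Opposite orientation: the
conjugate rectangle `R*` carries the datum `(conj ∘ φ ∘ (-conj), -x)` (`exists_conjugate`) whose
quadruple has the orientation of `x'` and the same cross-ratio (`crossRatio_neg`); 3a gives
`Ψ : R* → R'`, the jets of `R*` are those of `R` (3c, eventually in `δ`), and 3b concludes. -/
theorem higherJetLimitsConformal_of (hM : Stubs.stub_higherJetLimitsConformal_markedEquivalence)
    (hC : Stubs.stub_higherJetCovariance) (hX : Stubs.stub_mirrorCrossingRatio) :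
    (let w : Literature.Probability.RandomPlanarGeometry.ConformalRectangle → ℝ → ℂ → Set (Sym2 (Literature.Probability.LatticeModels.Site 2)) → ℂ := fun R δ s ω ↦ s ^ (ω.ncard + 2 * Nat.card ((Literature.Probability.Percolation.openGraph ω ⊔ Literature.Probability.LatticeModels.wired (Literature.Probability.LatticeModels.discreteArc R.carrier δ (R.arc 0) ∪ Literature.Probability.LatticeModels.discreteArc R.carrier δ (R.arc 2))).induce (Literature.Probability.LatticeModels.meshDomain R.carrier δ)).ConnectedComponent); let P : Literature.Probability.RandomPlanarGeometry.ConformalRectangle → ℝ → ℂ → ℂ := fun R δ s ↦ (∑ᶠ ω ∈ 𝒫 (Literature.Probability.LatticeModels.discreteDomainGraph R.carrier δ).edgeSet, (Literature.Probability.Percolation.discreteCrossing R.carrier δ (R.arc 0) (R.arc 2)).indicator (w R δ s) ω) / (∑ᶠ ω ∈ 𝒫 (Literature.Probability.LatticeModels.discreteDomainGraph R.carrier δ).edgeSet, w R δ s ω); ∀ n : ℕ, 1 ≤ n → ∀ (R R' : Literature.Probability.RandomPlanarGeometry.ConformalRectangle) (φ : Literature.Probability.RandomPlanarGeometry.ConformalEquiv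 UpperHalfPlane.upperHalfPlaneSet R.carrier) (x : Fin 4 → ℝ) (φ' : Literature.Probability.RandomPlanarGeometry.ConformalEquiv UpperHalfPlane.upperHalfPlaneSet R'.carrier) (x' : Fin 4 → ℝ) (L L' : ℂ), R.IsUniformizing φ x → R'.IsUniformizing φ' x' → Literature.Probability.RandomPlanarGeometry.crossRatio x = Literature.Probability.RandomPlanarGeometry.crossRatio x' → Filter.Tendsto (fun δ ↦ iteratedDeriv n (P R δ) (Real.sqrt 2 : ℂ)) (nhdsWithin 0 (Set.Ioi 0)) (nhds L) → Filter.Tendsto (fun δ ↦ iteratedDeriv n (P R' δ) (Real.sqrt 2 : ℂ)) (nhdsWithin 0 (Set.Ioi 0)) (nhds L') → L = L') := by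
  unfold Stubs.stub_higherJetLimitsConformal_markedEquivalence at hM
  unfold Stubs.stub_higherJetCovariance at hC
  unfold Stubs.stub_mirrorCrossingRatio at hX
  intro w P n hn R R' φ x φ' x' L L' hU hU' hcr hL hL'
  by_cases hor : (StrictMono x ↔ StrictMono x')
  · obtain ⟨Ψ, hΨ⟩ := hM R R' φ x φ' x' hU hU' hor hcr
    exact hC n hn R R' Ψ hΨ L L' hL hL'
  · obtain ⟨ψ, -, hUc⟩ := hU.exists_conjugate
    have hexcl : ¬ (StrictMono x ∧ StrictAnti x) := fun h ↦ by
      have h1 := h.1 (show (0 : Fin 4) < 1 by decide)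
      have h2 := h.2 (show (0 : Fin 4) < 1 by decide)
      exact lt_asymm h1 h2
    have hneg : StrictMono (-x) ↔ StrictAnti x :=
      ⟨fun h ↦ by simpa using h.neg, fun h ↦ h.neg⟩
    have hx := hU.1
    have hor' : (StrictMono (-x) ↔ StrictMono x') := by tauto
    have hcr' : Literature.Probability.RandomPlanarGeometry.crossRatio (-x) = Literature.Probability.RandomPlanarGeometry.crossRatio x' := by
      rw [Literature.Probability.RandomPlanarGeometry.crossRatio_neg]; exact hcr
    obtain ⟨Ψ, hΨ⟩ := hM R.conjugate R' ψ (-x) φ' x' hUc hU' hor' hcr'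
    refine hC n hn R.conjugate R' Ψ hΨ L L' ?_ hL'
    refine hL.congr' ?_
    filter_upwards [self_mem_nhdsWithin] with δ hδ
    exact congrArg (fun f : ℂ → ℂ ↦ iteratedDeriv n f (Real.sqrt 2 : ℂ))
      (funext fun s ↦ (hX R δ hδ s).symm)

/-- **The composition** — hypotheses = the five OPEN stub `Prop`s BY NAME (stub 0 = the named fact Chelkak–Smirnov 2012 Thm 6.1,
DESIGN⁺ and DESIGN⁻ of reshape 3 — through which stub 1′ is derived with the landed assembly theorems —, stubs 2, 3b),
conclusion = the crux BY NAME; the two CLOSED stubs (3a marked equivalence, 3c mirror symmetry) are discharged inside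
the proof by their landed theorems. `n = 0`: stub 1 after `iteratedDeriv_zero`. `n = k + 1`: `c η :=` the
stub-2 limit of SOME conformal rectangle with a uniformizing datum of cross-ratio `η` (chosen; `0` if
there is none); for the given `(R, φ, x)` stub 2 gives a limit `L`, and the derived
`higherJetLimitsConformal_of` identifies `L` with the chosen representative's. -/
theorem IsingJetsConformal_of
    (hCS : Stubs.stub_chelkakSmirnovQuadrilateralCrossing) (hG : Stubs.stub_design_meshQuad)
    (hE : Stubs.stub_higherJetLimitsExist) (hCov : Stubs.stub_higherJetCovariance) :
    IsingJetsConformal := by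
  have hDp : Stubs.stub_design_upper := design_upper_of hG
  have hDm : Stubs.stub_design_lower := design_lower_of hG
  have hAp : Stubs.stub_assembly_upper := stub_loopSymmetricLimit_assemblyUpper
  have hAm : Stubs.stub_assembly_lower := stub_loopSymmetricLimit_assemblyLower
  have hB : Stubs.stub_loopSymmetricLimit_of_chelkakSmirnov := loopSymmetricLimit_of_chelkakSmirnov_of hDp hDm hAp hAm
  have h0 : Stubs.stub_isingCrossingConformal := isingCrossingConformal_of hCS hB
  have hM : Stubs.stub_higherJetLimitsConformal_markedEquivalence :=
    stub_higherJetLimitsConformal_markedEquivalence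
  have hX : Stubs.stub_mirrorCrossingRatio := stub_mirrorCrossingRatio
  have hC := higherJetLimitsConformal_of hM hCov hX
  unfold Stubs.stub_isingCrossingConformal at h0
  unfold Stubs.stub_higherJetLimitsExist at hE
  intro n
  cases n with
  | zero =>
    obtain ⟨c, hc⟩ := h0
    refine ⟨c, fun R φ x hU => ?_⟩
    simp only [iteratedDeriv_zero]
    exact hc R φ x hU
  | succ k =>
    have hn : 1 ≤ k + 1 := Nat.succ_le_succ (Nat.zero_le k)
    refine ⟨fun η ↦ if h : ∃ (R' : Literature.Probability.RandomPlanarGeometry.ConformalRectangle) (φ' : Literature.Probability.RandomPlanarGeometry.ConformalEquiv UpperHalfPlane.upperHalfPlaneSet R'.carrier) (x' : Fin 4 → ℝ),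
        R'.IsUniformizing φ' x' ∧ Literature.Probability.RandomPlanarGeometry.crossRatio x' = η then Classical.choose (hE (k + 1) hn h.choose) else 0,
      fun R φ x hU => ?_⟩
    obtain ⟨L, hL⟩ := hE (k + 1) hn R
    have hex : ∃ (R' : Literature.Probability.RandomPlanarGeometry.ConformalRectangle) (φ' : Literature.Probability.RandomPlanarGeometry.ConformalEquiv UpperHalfPlane.upperHalfPlaneSet R'.carrier) (x' : Fin 4 → ℝ),
        R'.IsUniformizing φ' x' ∧ Literature.Probability.RandomPlanarGeometry.crossRatio x' = Literature.Probability.RandomPlanarGeometry.crossRatio x := ⟨R, φ, x, hU, rfl⟩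
    obtain ⟨φ', x', hU', hη'⟩ := hex.choose_spec
    have hLL : L = Classical.choose (hE (k + 1) hn hex.choose) :=
      hC (k + 1) hn R hex.choose φ x φ' x' L _ hU hU' hη'.symm hL
        (Classical.choose_spec (hE (k + 1) hn hex.choose))
    beta_reduce
    rw [dif_pos hex, ← hLL]
    exact hL

/-- The skeleton IS the crux proof once the four open registered stubs (0, G1, 2, 3b) are discharged: the spelled-out
stub signatures are definitionally the named `Prop`s (an `example`, so that `IsingJetsConformal_of`
stays the file's only theorem concluding the crux). -/
example : IsingJetsConformal :=
  IsingJetsConformal_of stub_chelkakSmirnovQuadrilateralCrossing stub_design_meshQuad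
    stub_higherJetLimitsExist stub_higherJetCovariance

end Summit.CriticalPhenomena.CardyFormulaZ2.Cruxes.IsingJetsConformal.Birth
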